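import Summits.CriticalPhenomena.Ising3D.Control2DEps105Cuts
import HarnessLib

/-!
# The 2D control: obligation (C) of certificate `eps105` IN THE KERNEL — spins 0
(cell `pub-ising3x`, seat controls-1; kernel runs of `Control2DCellCheck.checkSpin`)

HONEST FRAMING: lottery ticket; floor = tightest certified 3D Ising CFT bounds; no exact-solution claim without a proof.

Kernel evaluations (`decide +kernel`; no `native_decide`, no extra axioms) of the (C) checker at
precision `P = 80` on the data of certificate `eps105` (weights `eps105_w`, nodes `eps1005_z/zb`,
`Δ_σ = 1/8`), one per cut list of `Control2DEps105Cuts.lean`: each certifies the two value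
inequalities of the linear log-free cell scheme on every cell of its list (`checkSpin = true`), hence —
by `Control2DCellSound.cellPositive_of_checkSpin` and the kernel (M)+(T) of `Control2DEps105Mid.lean` —
block positivity `φ[F_-[g_{Δ,ℓ}]] ≥ 0` for every `Δ` in the range of the list (assembled in
`Control2DEps105.lean`). Kernel time ≈ 0.4 s per cut point (farm, 2026-08-20).
-/

namespace Summit.CriticalPhenomena.Ising3D.Control2D.RB0

open Set
open Literature.MathematicalPhysics.QuantumFieldTheory.ConformalBootstrap3D
open Summit.CriticalPhenomena.Ising3D.Control2D

set_option maxHeartbeats 10000000 in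
set_option maxRecDepth 200000 in
/-- (C) of `eps105`, spin `0`, cells of `eps105_cuts0a` (`118` cells, `N = 32`, depth `15`). [folklore] -/
theorem eps105_check_cuts0a :
    checkSpin 80 32 0 (eps105_vals.map (NI.ofRat 80)) (mkCData 80 15 0 eps105_vals eps105_w eps1005_z eps1005_zb)
      eps105_cuts0a (4345/4096) = true := by
  decide +kernel

set_option maxHeartbeats 10000000 in
set_option maxRecDepth 200000 in
/-- (C) of `eps105`, spin `0`, cells of `eps105_cuts0b` (`118` cells, `N = 32`, depth `13`). [folklore] -/
theorem eps105_check_cuts0b :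
    checkSpin 80 32 0 (eps105_vals.map (NI.ofRat 80)) (mkCData 80 13 0 eps105_vals eps105_w eps1005_z eps1005_zb)
      eps105_cuts0b (1149/1024) = true := by
  decide +kernel

set_option maxHeartbeats 10000000 in
set_option maxRecDepth 200000 in
/-- (C) of `eps105`, spin `0`, cells of `eps105_cuts0c` (`119` cells, `N = 32`, depth `11`). [folklore] -/
theorem eps105_check_cuts0c :
    checkSpin 80 32 0 (eps105_vals.map (NI.ofRat 80)) (mkCData 80 11 0 eps105_vals eps105_w eps1005_z eps1005_zb)
      eps105_cuts0c (13/8) = true := by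
  decide +kernel

set_option maxHeartbeats 10000000 in
set_option maxRecDepth 200000 in
/-- (C) of `eps105`, spin `0`, cells of `eps105_cuts0d` (`118` cells, `N = 32`, depth `7`). [folklore] -/
theorem eps105_check_cuts0d :
    checkSpin 80 32 0 (eps105_vals.map (NI.ofRat 80)) (mkCData 80 7 0 eps105_vals eps105_w eps1005_z eps1005_zb)
      eps105_cuts0d (97/4) = true := by
  decide +kernel

end Summit.CriticalPhenomena.Ising3D.Control2D.RB0
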